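import Summits.Ventures.PercRepro.C041TriangleLeafStar3MarkCoord0
import Summits.Ventures.PercRepro.C041TriangleLeafStar3MarkCoord1
import Summits.Ventures.PercRepro.C041TriangleLeafStar3MarkCoord2
import Summits.Ventures.PercRepro.C041TriangleLeafStar3MarkCoord3
import Summits.Ventures.PercRepro.C041TriangleLeafStar3MarkCoord4
import Summits.Ventures.PercRepro.C041TriangleLeafStar3MarkCoord5

/-!
# THEOREM (LEAF × THREE LEAVES + MARK) — `θ_△(v d, v a * v b * v c * v 1) ∈ cone` for all variables in `[0, 1]` (mine-3, gen 67; C-041.md §21 (bg))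

The certificate is the exact Bernstein-quadratic identity `thetaTri_leafStar3Mark_eq`: `θ_△(v d, v a * v b * v c * v 1) = leafStar3MarkA a b c d + leafStar3MarkB a b c d + leafStar3MarkC a b c d + leafStar3MarkD a b c d + leafStar3MarkE a b c d + leafStar3MarkF a b c d + leafStar3MarkG a b c d + leafStar3MarkH a b c d + leafStar3MarkI a b c d` (an exact kit-LP
vertex: 138 generators, 1637 terms, HiGHS support search + exact rational re-solve, re-verified exactly by
tools/g67/gen_cert.py before emission), checked coordinate by coordinate by `ring`; each part is a cone element (every
coefficient a non-negative combination of Bernstein-quadratic monomials, every generator a product of at most two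
leaves at atoms in `[0, 1]`).
-/

namespace PercRepro

namespace RelaxedTriangle

open TreeClosure

/-- **THE IDENTITY**: `θ_△(v d, v a * v b * v c * v 1) = leafStar3MarkA a b c d + leafStar3MarkB a b c d + leafStar3MarkC a b c d + leafStar3MarkD a b c d + leafStar3MarkE a b c d + leafStar3MarkF a b c d + leafStar3MarkG a b c d + leafStar3MarkH a b c d + leafStar3MarkI a b c d`. -/
theorem thetaTri_leafStar3Mark_eq (a b c d : ℝ) :
    thetaTri (v d) (v a * v b * v c * v 1) = leafStar3MarkA a b c d + leafStar3MarkB a b c d + leafStar3MarkC a b c d + leafStar3MarkD a b c d + leafStar3MarkE a b c d + leafStar3MarkF a b c d + leafStar3MarkG a b c d + leafStar3MarkH a b c d + leafStar3MarkI a b c d := by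
  ext i
  fin_cases i
  · exact thetaTri_leafStar3Mark_coord0 a b c d
  · exact thetaTri_leafStar3Mark_coord1 a b c d
  · exact thetaTri_leafStar3Mark_coord2 a b c d
  · exact thetaTri_leafStar3Mark_coord3 a b c d
  · exact thetaTri_leafStar3Mark_coord4 a b c d
  · exact thetaTri_leafStar3Mark_coord5 a b c d

/-- **THEOREM (LEAF × THREE LEAVES + MARK)**: `θ_△(v d, v a * v b * v c * v 1) ∈ cone` for all variables in `[0, 1]`. -/
theorem InCone_thetaTri_leafStar3Mark (a b c d : ℝ) (ha : 0 ≤ a ∧ a ≤ 1) (hb : 0 ≤ b ∧ b ≤ 1) (hc : 0 ≤ c ∧ c ≤ 1) (hd : 0 ≤ d ∧ d ≤ 1) :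
    InCone (thetaTri (v d) (v a * v b * v c * v 1)) := by
  rw [thetaTri_leafStar3Mark_eq]
  exact (((((((((InCone_leafStar3MarkA a b c d ha hb hc hd).add (InCone_leafStar3MarkB a b c d ha hb hc hd)).add (InCone_leafStar3MarkC a b c d ha hb hc hd)).add (InCone_leafStar3MarkD a b c d ha hb hc hd)).add (InCone_leafStar3MarkE a b c d ha hb hc hd)).add (InCone_leafStar3MarkF a b c d ha hb hc hd)).add (InCone_leafStar3MarkG a b c d ha hb hc hd)).add (InCone_leafStar3MarkH a b c d ha hb hc hd)).add (InCone_leafStar3MarkI a b c d ha hb hc hd))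

end RelaxedTriangle

end PercRepro
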